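import Summits.AtomisticToContinuum.HydrodynamicLimit.Theorems.AntiMazurCoboundariesKineticWindowGronwallReorthCutPrelim
import HarnessLib

/-!
# The re-orthogonalising cut (stub `stub_reorthCut`, line `rare-band-ladder-dock`, file 2 of 2)

Crux `Summit.AtomisticToContinuum.HydrodynamicLimit.Theses.AntiMazurCoboundaries.KineticWindowGronwall`
(stmt-AtomisticToContinuum-9282, `= KineticFluxLdDecay → RelEntropyVanishing`), skeleton line `rare-band-ladder-dock`
(v2), registered stub `stub_reorthCut : ReorthogonalisingCut` — the purely static decomposition lemma behind the
amplitude ladder `KineticFluxLdDecay ∧ RareBandLdDecay → QuadraticClassLdDecay`: for every bulk radius `V₁ > 0` there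
is `K = K(V₁) > 0` such that every continuous `g` with `|g w| ≤ c(1 + ‖w‖²)` and `g ⊥ (1, w, ‖w‖²)` in
`L²(stdGaussian)` splits as `g = G₁ + G₂`, `G₁` continuous, `|G₁| ≤ K c`, orthogonal; `G₂` continuous, orthogonal,
`= 0` on `‖w‖ ≤ V₁`, `|G₂ w| ≤ K c ‖w‖²`. The statements `Orth`, `ReorthogonalisingCut` are re-declared verbatim from
the registered skeleton `Cruxes/KineticWindowGronwall/Lines/rare_band_ladder_dock.lean` (§1, §1b).

PROOF (all profiles are functions of `s = ‖w‖²`, `L := V₁²`). Cutoff `χ = χ_L` (`= 1` on `s ≤ L`, `= 0` beyond `2L`,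
toolkit `cutoff_props`), tents `ζ_A` (support `[L, L+2]`, `ζ_A(L+1) = 1`) and `ζ_B` (support `[L+3, L+5]`). The
re-orthogonaliser `ν = (a₀ + ∑ a_k w_k) ζ_A(s) + a₄ ζ_B(s)` must have the five moments of `F := gχ` against
`1, w_j, ‖w‖²`. By oddness and coordinate swaps the Gram system is diagonal in the coordinates
(`a_j m₂ = ∫ F w_j`, `m₂ = ∫ w₀² ζ_A > 0`) and a `2 × 2` system in `(a₀, a₄)` with matrix
`[[∫ζ_A, ∫ζ_B], [∫ζ_A s, ∫ζ_B s]]`, whose determinant is `≥ ∫ζ_A ∫ζ_B > 0` because `∫ζ_B s ≥ (L+3)∫ζ_B` and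
`∫ζ_A s ≤ (L+2)∫ζ_A` (disjoint radial supports; the Gaussian charges open sets). Cramer; `|∫ F ψ_k| ≤ 4c(1 + 2L)`
since `F` is bounded by `c(1 + 2L)` and `∫(1 + ‖w‖²)dγ = 4`; hence `sup|ν| ≤ c B(V₁)`. `G₁ := F − ν` (bounded,
orthogonal by file 1 `orth_corr`), `G₂ := g(1 − χ) + ν = g − G₁` (orthogonal by difference, vanishing on `s ≤ L`, and
`≤ K c s` off the bulk since `1 ≤ s/L` there). Folklore Gaussian calculus; nothing is cited.
-/

noncomputable section

open MeasureTheory ProbabilityTheory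
open scoped ENNReal InnerProductSpace

namespace Summit.AtomisticToContinuum.HydrodynamicLimit.Theorems.KineticWindowGronwallReorthCut

open Literature.MathematicalPhysics.KineticTheory (V3)
open KineticCurrentsWindowLDUniformSketch.ClassTruncation
open ClampedCurrentsDockCutoff (cutoff_eq_one tent_props)

/-! ### The statements (verbatim from the line skeleton `rare_band_ladder_dock`) -/

/-- The orthogonality clause of all kinetic statements of this line (verbatim the clause of `KineticFluxLdDecay`):
`g ⊥ span{1, w, ‖w‖²}` in `L²(stdGaussian)` — the thermal-frame collision invariants. -/
def Orth (g : V3 → ℝ) : Prop :=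
  ∀ (c₀ c₂ : ℝ) (b : V3), ∫ v, g v * (c₀ + inner ℝ b v + c₂ * ‖v‖ ^ 2) ∂(ProbabilityTheory.stdGaussian V3) = 0

/-- **THE RE-ORTHOGONALISING CUT** (static; pure Gaussian analysis, the TRIAGE-r1-1 / Disproof §10.2 repair as a lemma):
for every bulk radius `V₁ > 0` there is a constant `K = K(V₁) > 0` such that every continuous `g` of quadratic growth
`|g w| ≤ c (1 + ‖w‖²)` with `g ⊥ span(1, w, ‖w‖²)` splits as `g = G₁ + G₂` with `G₁` continuous, BOUNDED by `K c` and
orthogonal, and `G₂` continuous, orthogonal, VANISHING on the bulk ball `‖w‖ ≤ V₁` and with `|G₂ w| ≤ K c ‖w‖²`. Proof plan: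
continuous cut-off `χ = 1` on `‖w‖ ≤ V₁`, `0` beyond `V₁ + 1`; re-orthogonaliser `ν = Σⱼ aⱼ ψⱼ ζ` supported in the bounded shell
`V₁ < ‖w‖ < V₁ + 2` (`ψ = (1, w₁, w₂, w₃, ‖w‖²)`, `ζ ≥ 0` a continuous radial bump vanishing on `[0, V₁]`; the linear map
`a ↦ (⟨Σⱼ aⱼψⱼζ, ψₖ⟩_γ)ₖ` is injective — `⟨ν, Σ aₖψₖ⟩ = ∫ (Σ aⱼψⱼ)² ζ dγ = 0` forces the polynomial to vanish on the open shell —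
hence invertible with a bounded inverse; or explicitly: with `ζ` radial the Gram matrix is block-diagonal by oddness, the `{1, ‖w‖²}`
block nonsingular by Cauchy–Schwarz); `a := Gram⁻¹ ⟨gχ, ψ⟩`, `|⟨gχ, ψₖ⟩| ≤ c ∫ (1 + ‖w‖²)|ψₖ| dγ`; `G₁ := gχ − ν`, `G₂ := g(1 − χ) + ν`. -/
def ReorthogonalisingCut : Prop :=
  ∀ V₁ : ℝ, 0 < V₁ → ∃ K : ℝ, 0 < K ∧
    ∀ (c : ℝ) (g : V3 → ℝ), 0 ≤ c → Continuous g → (∀ w, |g w| ≤ c * (1 + ‖w‖ ^ 2)) → Orth g →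
      ∃ G₁ G₂ : V3 → ℝ, Continuous G₁ ∧ Continuous G₂ ∧ (∀ w, g w = G₁ w + G₂ w) ∧
        (∀ w, |G₁ w| ≤ K * c) ∧ Orth G₁ ∧
        (∀ w, ‖w‖ ≤ V₁ → G₂ w = 0) ∧ (∀ w, |G₂ w| ≤ K * c * ‖w‖ ^ 2) ∧ Orth G₂

/-! ### The stub -/

/-- **Stub `stub_reorthCut`** (line `rare-band-ladder-dock`, crux stmt-AtomisticToContinuum-9282): the static
re-orthogonalising cut. All profiles are functions of `s = ‖w‖²`: cutoff `χ_L`, `L = V₁²` (`= 1` on `s ≤ L`, `= 0` beyond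
`2L`), tents `ζ_A` (support `[L, L+2]`) and `ζ_B` (support `[L+3, L+5]`); the re-orthogonaliser
`ν = (a₀ + ∑ a_k w_k) ζ_A + a₄ ζ_B` solves a Gram system which is diagonal in the coordinates (oddness, swaps) and a
`2 × 2` system in `(a₀, a₄)` with determinant `∫ζ_A ∫ζ_B‖w‖² − ∫ζ_A‖w‖² ∫ζ_B ≥ ∫ζ_A ∫ζ_B > 0` (disjoint radial supports;
the Gaussian charges open sets). `G₁ := gχ − ν`, `G₂ := g − G₁`; all constants are explicit in the five moments of
`ζ_A, ζ_B` and linear in `c`. [folklore] -/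
theorem stub_reorthCut : ReorthogonalisingCut := by
  intro V₁ hV₁
  /- Step 1: profiles in `s = ‖w‖²`. -/
  obtain ⟨L, hL⟩ : ∃ L : ℝ, L = V₁ ^ 2 := ⟨_, rfl⟩
  have hL0 : 0 < L := hL ▸ pow_pos hV₁ 2
  obtain ⟨χ, hχ⟩ : ∃ χ : ℝ → ℝ, ∀ s, χ s = min 1 (max 0 (2 - s / L)) := ⟨_, fun s => rfl⟩
  obtain ⟨hχc, hχ0, hχ1, hχhi, -⟩ := cutoff_props hL0 hχ
  have hχlo := cutoff_eq_one hL0 hχ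
  obtain ⟨ζA, hζA⟩ : ∃ r : ℝ → ℝ, ∀ t, r t = max 0 (1 - |t - (L + 1)|) := ⟨_, fun t => rfl⟩
  obtain ⟨hAc, hA0, hA1, hAlo, hAhi, hAone⟩ := tent_props L hζA
  obtain ⟨ζB, hζB⟩ : ∃ r : ℝ → ℝ, ∀ t, r t = max 0 (1 - |t - (L + 3 + 1)|) := ⟨_, fun t => rfl⟩
  obtain ⟨hBc, hB0, hB1, hBlo, -, hBone⟩ := tent_props (L + 3) hζB
  /- Step 2: the five Gram moments and the determinant. -/
  obtain ⟨mA, hmA⟩ : ∃ m : ℝ, m = ∫ w, ζA (‖w‖ ^ 2) ∂stdGaussian V3 := ⟨_, rfl⟩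
  obtain ⟨mB, hmB⟩ : ∃ m : ℝ, m = ∫ w, ζB (‖w‖ ^ 2) ∂stdGaussian V3 := ⟨_, rfl⟩
  obtain ⟨sA, hsA⟩ : ∃ m : ℝ, m = ∫ w, ζA (‖w‖ ^ 2) * ‖w‖ ^ 2 ∂stdGaussian V3 := ⟨_, rfl⟩
  obtain ⟨sB, hsB⟩ : ∃ m : ℝ, m = ∫ w, ζB (‖w‖ ^ 2) * ‖w‖ ^ 2 ∂stdGaussian V3 := ⟨_, rfl⟩
  obtain ⟨m₂, hm₂⟩ : ∃ m : ℝ, m = ∫ w, w 0 * w 0 * ζA (‖w‖ ^ 2) ∂stdGaussian V3 := ⟨_, rfl⟩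
  have hmA0 : 0 < mA :=
    hmA ▸ integral_weight_pos hAc hA0 hA1 (t := L + 1) (by positivity) (by rw [hAone]; exact one_ne_zero)
  have hmB0 : 0 < mB :=
    hmB ▸ integral_weight_pos hBc hB0 hB1 (t := L + 3 + 1) (by positivity)
      (by rw [hBone]; exact one_ne_zero)
  have hm₂0 : 0 < m₂ :=
    hm₂ ▸ integral_coord_sq_weight_pos hAc hA0 hA1 (t := L + 1) (by positivity)
      (by rw [hAone]; exact one_ne_zero)
  have hsA0 : 0 ≤ sA := hsA ▸ integral_nonneg fun w => mul_nonneg (hA0 _) (sq_nonneg _)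
  have hsAle : sA ≤ (L + 2) * mA := by
    rw [hsA, hmA]; exact integral_weight_norm_sq_le hAc hA0 hA1 hAhi
  have hsBge : (L + 3) * mB ≤ sB := by
    rw [hsB, hmB]; exact le_integral_weight_norm_sq hBc hB0 hB1 hBlo
  obtain ⟨D, hD⟩ : ∃ D : ℝ, D = mA * sB - sA * mB := ⟨_, rfl⟩
  have hDge : mA * mB ≤ D := by
    have h1 := mul_le_mul_of_nonneg_left hsBge hmA0.le
    have h2 := mul_le_mul_of_nonneg_right hsAle hmB0.le
    rw [hD]; linarith
  have hD0 : 0 < D := lt_of_lt_of_le (mul_pos hmA0 hmB0) hDge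
  /- Step 3: the constant `K = K(V₁)`. -/
  obtain ⟨P, hP⟩ : ∃ P : ℝ, P = 4 * (1 + 2 * L) := ⟨_, rfl⟩
  have hP0 : 0 < P := by rw [hP]; positivity
  obtain ⟨Be, hBe⟩ : ∃ B : ℝ, B = P * (sB + mB) / D + P * (mA + sA) / D := ⟨_, rfl⟩
  obtain ⟨Bo, hBo⟩ : ∃ B : ℝ, B = 3 * (P / m₂) * (L + 3) := ⟨_, rfl⟩
  have hsB0 : 0 < sB := lt_of_lt_of_le (by positivity) hsBge
  have hBe0 : 0 ≤ Be := by rw [hBe]; positivity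
  have hBo0 : 0 ≤ Bo := by rw [hBo]; positivity
  obtain ⟨K, hK⟩ : ∃ K : ℝ, K = (1 + 2 * L) + Be + Bo + (1 / L + 1 + (Be + Bo) / L) := ⟨_, rfl⟩
  have hK₁ : (1 + 2 * L) + Be + Bo ≤ K := by
    have h1 : 0 ≤ 1 / L := by positivity
    have h2 : 0 ≤ (Be + Bo) / L := by positivity
    rw [hK]; linarith
  have hK₂ : 1 / L + 1 + (Be + Bo) / L ≤ K := by rw [hK]; linarith
  refine ⟨K, by rw [hK]; positivity, fun c g hc hgc hgb hgo => ?_⟩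
  /- Step 4: the truncated profile `F = g χ` and its moments `|∫ F ψ_k| ≤ c P`. -/
  obtain ⟨F, hF⟩ : ∃ F : V3 → ℝ, F = fun w => g w * χ (‖w‖ ^ 2) := ⟨_, rfl⟩
  have hFw : ∀ w, F w = g w * χ (‖w‖ ^ 2) := fun w => by rw [hF]
  have hFc : Continuous F := by rw [hF]; fun_prop
  have hFb : ∀ w, |F w| ≤ c * (1 + 2 * L) := by
    intro w
    rw [hFw, abs_mul, abs_of_nonneg (hχ0 _)]
    by_cases h : 2 * L ≤ ‖w‖ ^ 2
    · rw [hχhi _ h, mul_zero]; positivity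
    · calc |g w| * χ (‖w‖ ^ 2) ≤ c * (1 + ‖w‖ ^ 2) * 1 :=
            mul_le_mul (hgb w) (hχ1 _) (hχ0 _) (by positivity)
        _ ≤ c * (1 + 2 * L) := by
            rw [mul_one]; exact mul_le_mul_of_nonneg_left (by linarith [not_le.1 h]) hc
  have hFb' : ∀ w, |F w| ≤ c * (1 + 2 * L) * (1 + ‖w‖ ^ 2) := fun w =>
    le_mul_one_add (hFb w) (by positivity) (sq_nonneg _)
  have hR₀ : |∫ w, F w ∂stdGaussian V3| ≤ c * P := by
    have h := abs_integral_mul_le hFb (ψ := fun _ => 1) fun w => by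
      rw [abs_one]; exact le_add_of_nonneg_right (sq_nonneg _)
    simp only [mul_one] at h
    exact h.trans (le_of_eq (by rw [hP]; ring))
  have hRj : ∀ j, |∫ w, F w * w j ∂stdGaussian V3| ≤ c * P := fun j =>
    (abs_integral_mul_le hFb (ψ := fun w => w j) fun w => abs_coord_le w j).trans
      (le_of_eq (by rw [hP]; ring))
  have hR₄ : |∫ w, F w * ‖w‖ ^ 2 ∂stdGaussian V3| ≤ c * P :=
    (abs_integral_mul_le hFb (ψ := fun w => ‖w‖ ^ 2) fun w => by
      rw [abs_of_nonneg (sq_nonneg _)]; exact le_add_of_nonneg_left zero_le_one).trans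
      (le_of_eq (by rw [hP]; ring))
  /- Step 5: Cramer: the coefficients of the re-orthogonaliser and their bounds. -/
  obtain ⟨a₀, ha₀⟩ : ∃ x : ℝ, x = ((∫ w, F w ∂stdGaussian V3) * sB -
    (∫ w, F w * ‖w‖ ^ 2 ∂stdGaussian V3) * mB) / D := ⟨_, rfl⟩
  obtain ⟨a₄, ha₄⟩ : ∃ x : ℝ, x = ((∫ w, F w * ‖w‖ ^ 2 ∂stdGaussian V3) * mA -
    (∫ w, F w ∂stdGaussian V3) * sA) / D := ⟨_, rfl⟩
  obtain ⟨a, ha⟩ : ∃ a : V3, a = WithLp.toLp 2 fun j => (∫ w, F w * w j ∂stdGaussian V3) / m₂ :=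
    ⟨_, rfl⟩
  have e₀ : a₀ * mA + a₄ * mB = ∫ w, F w ∂stdGaussian V3 := by
    rw [ha₀, ha₄, div_mul_eq_mul_div, div_mul_eq_mul_div, ← add_div, div_eq_iff hD0.ne', hD]
    ring
  have e₄ : a₀ * sA + a₄ * sB = ∫ w, F w * ‖w‖ ^ 2 ∂stdGaussian V3 := by
    rw [ha₀, ha₄, div_mul_eq_mul_div, div_mul_eq_mul_div, ← add_div, div_eq_iff hD0.ne', hD]
    ring
  have e : ∀ j, a j * m₂ = ∫ w, F w * w j ∂stdGaussian V3 := fun j => by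
    rw [ha, PiLp.toLp_apply, div_mul_cancel₀ _ hm₂0.ne']
  have hba₀ : |a₀| ≤ c * (P * (sB + mB) / D) := ha₀ ▸ cramer_abs_le hD0 hsB0.le hmB0.le hR₀ hR₄
  have hba₄ : |a₄| ≤ c * (P * (mA + sA) / D) := ha₄ ▸ cramer_abs_le hD0 hmA0.le hsA0 hR₄ hR₀
  have hba : ∀ k, |a k| ≤ c * P / m₂ := fun k => by
    rw [ha, PiLp.toLp_apply, abs_div, abs_of_pos hm₂0]
    exact div_le_div_of_nonneg_right (hRj k) hm₂0.le
  /- Step 6: the even and odd parts `E`, `O` of the re-orthogonaliser: sup bounds, bulk vanishing. -/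
  obtain ⟨E, hE⟩ : ∃ E : V3 → ℝ, E = fun w => a₀ * ζA (‖w‖ ^ 2) + a₄ * ζB (‖w‖ ^ 2) := ⟨_, rfl⟩
  obtain ⟨O, hO⟩ : ∃ O : V3 → ℝ, O = fun w => (∑ k, a k * w k) * ζA (‖w‖ ^ 2) := ⟨_, rfl⟩
  have hEw : ∀ w, E w = a₀ * ζA (‖w‖ ^ 2) + a₄ * ζB (‖w‖ ^ 2) := fun w => by rw [hE]
  have hOw : ∀ w : V3, O w = (∑ k, a k * w k) * ζA (‖w‖ ^ 2) := fun w => by rw [hO]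
  have hEc : Continuous E := by rw [hE]; fun_prop
  have hOc : Continuous O := by rw [hO]; fun_prop
  have hEb : ∀ w, |E w| ≤ c * Be := by
    intro w
    rw [hEw]
    calc _ ≤ |a₀ * ζA (‖w‖ ^ 2)| + |a₄ * ζB (‖w‖ ^ 2)| := abs_add_le _ _
      _ ≤ |a₀| + |a₄| := by
          rw [abs_mul, abs_mul, abs_of_nonneg (hA0 _), abs_of_nonneg (hB0 _)]
          exact add_le_add (mul_le_of_le_one_right (abs_nonneg _) (hA1 _))
            (mul_le_of_le_one_right (abs_nonneg _) (hB1 _))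
      _ ≤ c * (P * (sB + mB) / D) + c * (P * (mA + sA) / D) := add_le_add hba₀ hba₄
      _ = c * Be := by rw [hBe]; ring
  have hOb : ∀ w, |O w| ≤ c * Bo := by
    intro w
    rw [hOw, abs_mul, abs_of_nonneg (hA0 _)]
    by_cases h : L + 2 ≤ ‖w‖ ^ 2
    · rw [hAhi _ h, mul_zero]; positivity
    · calc |∑ k, a k * w k| * ζA (‖w‖ ^ 2) ≤ 3 * (c * P / m₂) * (1 + ‖w‖ ^ 2) * 1 :=
            mul_le_mul (abs_lin_le_of_coord hba w) (hA1 _) (hA0 _) (by positivity)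
        _ ≤ 3 * (c * P / m₂) * (L + 3) * 1 :=
            mul_le_mul_of_nonneg_right (mul_le_mul_of_nonneg_left (by linarith [not_le.1 h])
              (by positivity)) zero_le_one
        _ = c * Bo := by rw [hBo]; ring
  have hEz : ∀ w, ‖w‖ ^ 2 ≤ L → E w = 0 := fun w hw => by
    rw [hEw, hAlo _ hw, hBlo _ (by linarith), mul_zero, mul_zero, add_zero]
  have hOz : ∀ w, ‖w‖ ^ 2 ≤ L → O w = 0 := fun w hw => by rw [hOw, hAlo _ hw, mul_zero]
  /- Step 7: the splitting `G₁ = F − E − O`, `G₂ = g(1 − χ) + E + O`. -/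
  have hG₁c : Continuous fun w => F w - E w - O w := by fun_prop
  have hG₁b : ∀ w, |F w - E w - O w| ≤ K * c := by
    intro w
    calc _ ≤ |F w| + |E w| + |O w| := (abs_sub _ _).trans (add_le_add (abs_sub _ _) le_rfl)
      _ ≤ c * (1 + 2 * L) + c * Be + c * Bo := add_le_add (add_le_add (hFb w) (hEb w)) (hOb w)
      _ = c * ((1 + 2 * L) + Be + Bo) := by ring
      _ ≤ c * K := mul_le_mul_of_nonneg_left hK₁ hc
      _ = K * c := mul_comm _ _
  have hG₁o : Orth fun w => F w - E w - O w := fun c₀ c₂ b => by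
    simp only [hE, hO]
    exact orth_corr hFc hFb' hAc hA0 hA1 hBc hB0 hB1 (by rw [← hmA, ← hmB, e₀])
      (fun j => by rw [← hm₂, e j]) (by rw [← hsA, ← hsB, e₄]) c₀ c₂ b
  refine ⟨fun w => F w - E w - O w, fun w => g w * (1 - χ (‖w‖ ^ 2)) + E w + O w, hG₁c,
    by fun_prop, fun w => by beta_reduce; rw [hFw]; ring, hG₁b, hG₁o, fun w hw => ?_, fun w => ?_,
    fun c₀ c₂ b => ?_⟩
  · have hs : ‖w‖ ^ 2 ≤ L := hL ▸ pow_le_pow_left₀ (norm_nonneg _) hw 2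
    show g w * (1 - χ (‖w‖ ^ 2)) + E w + O w = 0
    rw [hEz w hs, hOz w hs, hχlo _ hs]; ring
  · /- Step 8: the quadratic envelope of `G₂` off the bulk. -/
    show |g w * (1 - χ (‖w‖ ^ 2)) + E w + O w| ≤ K * c * ‖w‖ ^ 2
    by_cases hs : ‖w‖ ^ 2 ≤ L
    · rw [hEz w hs, hOz w hs, hχlo _ hs, sub_self, mul_zero, add_zero, add_zero, abs_zero, hK]
      positivity
    · refine envelope_abs_le hc hL0 (not_le.1 hs).le hBe0 hBo0 hK₂ ?_ (hEb w) (hOb w)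
      rw [abs_mul, abs_of_nonneg (sub_nonneg.2 (hχ1 _))]
      calc _ ≤ c * (1 + ‖w‖ ^ 2) * 1 := mul_le_mul (hgb w) (by linarith [hχ0 (‖w‖ ^ 2)])
            (sub_nonneg.2 (hχ1 _)) (by positivity)
        _ = _ := mul_one _
  · have h := orth_sub hgc hG₁c hgb
      (fun w => le_mul_one_add (hG₁b w) (by rw [hK]; positivity) (sq_nonneg _)) c₀ c₂ b
      (hgo c₀ c₂ b) (hG₁o c₀ c₂ b)
    have heq : (fun v : V3 => (g v * (1 - χ (‖v‖ ^ 2)) + E v + O v) *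
        (c₀ + inner ℝ b v + c₂ * ‖v‖ ^ 2)) =
        fun v => (g v - (F v - E v - O v)) * (c₀ + inner ℝ b v + c₂ * ‖v‖ ^ 2) := by
      funext v; rw [hFw]; ring
    show ∫ v, (g v * (1 - χ (‖v‖ ^ 2)) + E v + O v) * (c₀ + inner ℝ b v + c₂ * ‖v‖ ^ 2)
      ∂stdGaussian V3 = 0
    rw [heq]; exact h

end Summit.AtomisticToContinuum.HydrodynamicLimit.Theorems.KineticWindowGronwallReorthCut

end
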